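/-
Origin: expansion seat `planner-pub-hodgecm-mc-axioms-1-g14-0`, handover #W87 2026-08-20T15:53:55Z md5 cd2b87889c3c (PKG 9c3928903597 → cd2b87889c3c; 262 l.; MECHANICAL (iib-R) rewrite v3.1 of the PKG file as it stands (11 token edits; rules R1x2+RX[h₂']x9)) (`HOME/mc/pub-hodgecm-mc-axioms-1-g14/revendor/kit-r55/stage55/HodgeCM/Model/ArchKTypeOfLineSupplyR2.lean`, md5 cd2b87889c3c, 262 lines);
landed by the gen-22 packager (p-g22) in gate run 55 REPLACES the earlier landed copy of `HodgeCM/Model/ArchKTypeOfLineSupplyR2.lean` (seat copy carried the packager Origin header of an earlier run (stripped)).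
-/
/-
Copyright (c) 2026. Released under Apache 2.0 license as described in the file LICENSE.
Cell pub-hodgecm, MODEL layer (construction prover mc-carch-1, gen 5), BINDER-OWNERS rows 12 / 14 / 15 → row 17's (W-0-supply) AT PIN R2:
binder-1's `hsupply` text HYPOTHESIS-FREE under E's guard, for the doubly twisted line characters of period-1 #P50b.
-/
import Summits.HodgeConjecture.HodgeCM.Model.ArchKTypeOfLineSupply34
import Summits.HodgeConjecture.HodgeCM.Model.ArchKTypeOfLineR2Family

/-!
# (W-0-supply) for lines 2, 3 AT PIN R2: `SInstance.hsupply_two_three_R2_of_GOG`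

`ArchKTypeOfLineSupply34.hsupply_two_three_charG` proves binder-1's row-17 `hsupply` text (#56 `Real34CensusSideT.ofCensus` :192) at any
four-character side from the type facts `hdef₂ hdef₃ hχ₂ hχ₃`.  At pin R2 — line characters
`η₂ := etaT₂ V c.D (EtaChi.η χVR χW V c) (ν'R V c)`, `η₃ := etaT₃ V c.D (EtaChi.η χVR χW V c) (ν'R V c)` (period-1 #P50b; `χVR` = #CA35's constructed
V-character, `ν'R` = `ArchKTypeOfLineR2Family`'s second twist, `χW` ANY family), lines 0, 1 arbitrary (`η₀ η₁`) — those four facts are the guarded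
theorems `hdef_two/three_R2_of_GOG`, `hχ_two/three_R2_of_GOG`; continuity is #P50b `continuous_etaT₂/₃`; the sign, branch and positivity inputs are
`hG_GOG`, `hG.1`, `hpos_GOG`.  Hence:

* § 1 `hsupply_two_three_of_side_eq (e : S = archSideOfChar …)` — the text transported to any side propositionally equal to a four-character side
  (for sinst-1's constructed pins, cf. #1216 `SROGTC_eq_archSideOfT` + `archSideOfT_eq_archSideOfChar`);
* § 2 **`SInstance.hsupply_two_three_R2_of_GOG (χW) (V c) (hG : GOG V c) (η₀ η₁ hmaj hrat A) (hV)`** — `hsupply` at the side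
  `archSideOfChar V c (hGR V c) … η₀ η₁ (etaT₂ … (ν'R V c)) (etaT₃ … (ν'R V c)) hmaj hrat A`, NO hypothesis beyond the guard and the side's own data;
  § 3 the same at period-1's packaged R2 term `archSideOfT' V c … (EtaChi.η χVR χW V c) hη hηc ν hν hνc (ν'R V c) (hν'R V c) (hν'cR V c) (hG_GOG V c hG) A`
  (`archSideOfT'_eq_archSideOfChar`, `rfl`), any first twist `ν`: **`SInstance.hsupply_two_three_archSideOfT'_of_GOG`**.

So row 17's (W-0-supply) input is DISCHARGED at pin R2 for the vacuum line families `Z₂ Z₃` (degree-one `ι₁`-letter ⊗ vacuum elsewhere) — what remains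
of row 17 there is binder-1's `harch` (HARCH-PLAN (A″)) and the E-side re-pin (glue-1/sinst-1: the R2 child of E over `archSideOfT'`).
0 records, 0 `def … : Prop`, nothing cited as a hypothesis.
-/

set_option autoImplicit false

noncomputable section

open NumberField NumberField.InfinitePlace NumberField.mixedEmbedding IsDedekindDomain
open scoped Matrix TensorProduct Classical SchwartzMap
open MulAction
open Literature.Geometry.ComplexHyperbolic.BallModel (U21 x₀ stabilizerEquivK21)
open Literature.NumberTheory.Automorphic.U21 (K21 matA sclD)
open Literature.AlgebraicGeometry.HodgeTheory
open Literature.AlgebraicGeometry.ShimuraVarieties Literature.AlgebraicGeometry.ShimuraVarieties.BallForms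
open Literature.NumberTheory.Automorphic Literature.NumberTheory.Automorphic.UnitaryGroup Literature.NumberTheory.Weil1964
open Literature.RepresentationTheory.KonnoKonno2007 Literature.RepresentationTheory.KonnoKonno2007.RealDualPair
open Literature.NumberTheory.GelbartRogawski1991 Literature.NumberTheory.GelbartRogawski1991.UnitaryDualPair
open Literature.Analysis.SegalBargmann Literature.Analysis.Distribution
open Literature.NumberTheory.Automorphic.PicardCM
open HodgeCM.Adelic HodgeCM.PerL34 HodgeCM.Model.HypCensus HodgeCM.Model.SupplyInstance HodgeCM.Model.ArchSideTerm

namespace HodgeCM.Model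

/-! ## § 1 Transport to a propositionally equal side -/

section Transport

variable (hHD : exists_isReal_hodgeModel) (hI : hodgePQ_independent_of_hodgeModel)
  (h₁ : BallQuotientUniformised)  (h₃ : CMAbelianVarietyRealised)

variable {L : CMField} {ι₁ : L →+* ℂ} (V : HermSpace3 L ι₁) (c : SeesawCtx L)
variable
  (hGR : (cmSplittingDatum (L : Type) finProdFinEquiv (frameD V) (frameD_real V) (frameD_ne V) (dW c.D) (dW_real c.D) (dW_ne c.D)).CompatibleSplitting)
  (hGR₀ : (cmSplittingDatum (L : Type) (e₁) (frameD V) (frameD_real V) (frameD_ne V) (lineVec (L : Type) (dW c.D 0))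
    (fun _ => dW_real c.D 0) (fun _ => dW_ne c.D 0)).CompatibleSplitting)
  (hGR₁ : (cmSplittingDatum (L : Type) (e₁) (frameD V) (frameD_real V) (frameD_ne V) (lineVec (L : Type) (dW c.D 1))
    (fun _ => dW_real c.D 1) (fun _ => dW_ne c.D 1)).CompatibleSplitting)
  (hGR₂ : (cmSplittingDatum (L : Type) (e₁) (frameD V) (frameD_real V) (frameD_ne V) (lineVec (L : Type) (dW' c.D 0))
    (fun _ => dW'_real c.D 0) (fun _ => dW'_ne c.D 0)).CompatibleSplitting)
  (hGR₃ : (cmSplittingDatum (L : Type) (e₁) (frameD V) (frameD_real V) (frameD_ne V) (lineVec (L : Type) (dW' c.D 1))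
    (fun _ => dW'_real c.D 1) (fun _ => dW'_ne c.D 1)).CompatibleSplitting)
  (η₀ η₁ η₂ η₃ : CMAdelic (L : Type) (frameD V) × CMAdelicOne (L : Type) →* ℂˣ)
  (hmaj : ∀ k : Fin 4, HasThetaMajorants fun (p : ↥(regimeSubgroup L V.Hm) × ↥(NumberField.relNormOneIdeles (↥(maximalRealSubfield L)) L))
      (φ : piSchwartzBruhat (↥(maximalRealSubfield L)) (Fin 3)) => lineRepOf V c.D hGR hGR₀ hGR₁ hGR₂ hGR₃ η₀ η₁ η₂ η₃ k p φ)
  (hrat : ∀ k : Fin 4, ∀ γ ∈ (V.latticeModel printFact_unitaryCompact_holds).Γ,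
      ∀ t ∈ NumberField.relNormOneRat (↥(maximalRealSubfield L)) L,
        lineRepOf V c.D hGR hGR₀ hGR₁ hGR₂ hGR₃ η₀ η₁ η₂ η₃ k (γ, t) ∈ thetaStabilizerEnd (↥(maximalRealSubfield L)) (Fin 3))
  (h₁W : (∀ j, 0 < (ι₁ (dW c.D j)).re) ∨ ∀ j, (ι₁ (dW c.D j)).re < 0)
  (A : ∀ k : Fin 4, ArchLineInput V (lineRepOf V c.D hGR hGR₀ hGR₁ hGR₂ hGR₃ η₀ η₁ η₂ η₃ k))
  (hV : IsAnisotropic L V.Hm) (hemb : (InfinitePlace.mk ι₁).embedding = ι₁)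
  (hpos₂ : 0 < cmXW (L : Type) (frameD V) (lineVec (L : Type) (dW' c.D 0)) (fun _ => dW'_real c.D 0) ι₁ (HypCensus.cmPlace (L : Type) ι₁) 0)
  (hpos₃ : 0 < cmXW (L : Type) (frameD V) (lineVec (L : Type) (dW' c.D 1)) (fun _ => dW'_real c.D 1) ι₁ (HypCensus.cmPlace (L : Type) ι₁) 0)
  (hη₂c : Continuous fun p => ((η₂ p : ℂˣ) : ℂ)) (hη₃c : Continuous fun p => ((η₃ p : ℂˣ) : ℂ))
  (hdef₂ : ∀ b : {v : InfinitePlace ↥(maximalRealSubfield L) // v.IsReal}, b ≠ HypCensus.cmPlace (L : Type) ι₁ →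
    ∀ u : UnitaryGroup.archLocal (L : Type) 3 (Matrix.diagonal (frameD V)) (cmPlaceOver (L : Type) b),
      ((archScalar_twoG V c.D hGR hGR₂ hGR₃ η₂
          (UnitaryGroup.archSingle (↥(maximalRealSubfield L)) L (IsCMField.complexConj L) 3 (Matrix.diagonal (frameD V))
            (IsCMField.complexConj_ne_one L) (NumberField.complexConj_smul_infinitePlace (L : Type)) (cmPlaceOver (L : Type) b) u) : ℂˣ) : ℂ) *
        (((u : UnitaryGroup.archLocal (L : Type) 3 (Matrix.diagonal (frameD V)) (cmPlaceOver (L : Type) b)) : GL (Fin 3) ℂ) :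
            Matrix (Fin 3) (Fin 3) ℂ).det ^ defExponentTwo V c hGR₂ hpos₂ b = 1)
  (hdef₃ : ∀ b : {v : InfinitePlace ↥(maximalRealSubfield L) // v.IsReal}, b ≠ HypCensus.cmPlace (L : Type) ι₁ →
    ∀ u : UnitaryGroup.archLocal (L : Type) 3 (Matrix.diagonal (frameD V)) (cmPlaceOver (L : Type) b),
      ((archScalar_threeG V c.D hGR hGR₂ hGR₃ η₃
          (UnitaryGroup.archSingle (↥(maximalRealSubfield L)) L (IsCMField.complexConj L) 3 (Matrix.diagonal (frameD V))
            (IsCMField.complexConj_ne_one L) (NumberField.complexConj_smul_infinitePlace (L : Type)) (cmPlaceOver (L : Type) b) u) : ℂˣ) : ℂ) *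
        (((u : UnitaryGroup.archLocal (L : Type) 3 (Matrix.diagonal (frameD V)) (cmPlaceOver (L : Type) b)) : GL (Fin 3) ℂ) :
            Matrix (Fin 3) (Fin 3) ℂ).det ^ defExponentThree V c hGR₃ hpos₃ b = 1)
  (hχ₂ : ∀ u : stabilizer U21 x₀,
    ((lineScalar_two V c.D hGR hGR₂ hGR₃ η₂ (u : U21) : ℂˣ) : ℂ) *
        ((matA (stabilizerEquivK21.symm u)).det ^ (lineVacExponentsTwo V c hGR₂ (posIdxEquivUnit hpos₂) (negIdxEquivEmpty hpos₂)).eP *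
          sclD (stabilizerEquivK21.symm u) ^ (lineVacExponentsTwo V c hGR₂ (posIdxEquivUnit hpos₂) (negIdxEquivEmpty hpos₂)).eQ) =
      star (sclD (stabilizerEquivK21.symm u)))
  (hχ₃ : ∀ u : stabilizer U21 x₀,
    ((lineScalar_three V c.D hGR hGR₂ hGR₃ η₃ (u : U21) : ℂˣ) : ℂ) *
        ((matA (stabilizerEquivK21.symm u)).det ^ (lineVacExponentsThree V c hGR₃ (posIdxEquivUnit hpos₃) (negIdxEquivEmpty hpos₃)).eP *
          sclD (stabilizerEquivK21.symm u) ^ (lineVacExponentsThree V c hGR₃ (posIdxEquivUnit hpos₃) (negIdxEquivEmpty hpos₃)).eQ) =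
      star (sclD (stabilizerEquivK21.symm u)))

include hemb hη₂c hη₃c h₁W hdef₂ hdef₃ hχ₂ hχ₃ in
/-- **the `hsupply` text at ANY side propositionally equal to a four-character side** (`subst`). -/
theorem hsupply_two_three_of_side_eq (S : ThetaAdelicSide V c)
    (e : S = archSideOfChar V c hGR hGR₀ hGR₁ hGR₂ hGR₃ η₀ η₁ η₂ η₃ hmaj hrat A) :
    ∀ (x₂ x₃ : Fin 3 → FiniteAdeleRing (𝓞 ↥(maximalRealSubfield L)) ↥(maximalRealSubfield L)) (𝔫₂ 𝔫₃ : Ideal (𝓞 ↥(maximalRealSubfield L))),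
      ∃ (B₂ : ArchKTypeDataAt (thetaSpaceInputIn hHD hI h₁ h₃ S hV) 2 x₂ 𝔫₂) (B₃ : ArchKTypeDataAt (thetaSpaceInputIn hHD hI h₁ h₃ S hV) 3 x₃ 𝔫₃),
        B₃.Γ₀ = B₂.Γ₀ ∧
          B₂.Φarch = blockFamilyOfAt (L : Type) e₁ (frameD V) (frameD_real V) (frameD_ne V) (lineVec (L : Type) (dW' c.D 0)) (fun _ => dW'_real c.D 0)
            (fun _ => dW'_ne c.D 0) ι₁ (blockPosEquiv V) (blockNegEquiv V) (posIdxEquivUnit hpos₂) (negIdxEquivEmpty hpos₂) (degOnePDual Empty) (binvPi 1) ∧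
          B₃.Φarch = blockFamilyOfAt (L : Type) e₁ (frameD V) (frameD_real V) (frameD_ne V) (lineVec (L : Type) (dW' c.D 1)) (fun _ => dW'_real c.D 1)
            (fun _ => dW'_ne c.D 1) ι₁ (blockPosEquiv V) (blockNegEquiv V) (posIdxEquivUnit hpos₃) (negIdxEquivEmpty hpos₃) (degOnePDual Empty) (binvPi 1) ∧
          B₂.IsWeaklyPDiff BallForms.expP ∧
          (∀ p : Fin 2, B₂.IsPMinusKilledAlong BallForms.expP (-Complex.I • (Pi.single p 1 : Fin 2 → ℂ))) ∧
          B₃.IsWeaklyPDiff BallForms.expP ∧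
          (∀ p : Fin 2, B₃.IsPMinusKilledAlong BallForms.expP (-Complex.I • (Pi.single p 1 : Fin 2 → ℂ))) := by
  subst e
  exact hsupply_two_three_charG hHD hI h₁ h₃ V c hGR hGR₀ hGR₁ hGR₂ hGR₃ η₀ η₁ η₂ η₃ hmaj hrat h₁W A hV hemb hpos₂ hpos₃ hη₂c hη₃c hdef₂ hdef₃
    hχ₂ hχ₃

end Transport

/-! ## § 2 Pin R2 under the OG guard -/

namespace SInstance

variable (hHD : exists_isReal_hodgeModel) (hI : hodgePQ_independent_of_hodgeModel)
  (h₁ : BallQuotientUniformised)  (h₃ : CMAbelianVarietyRealised)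

variable
  (hGR : ∀ {L : CMField} {ι₁ : L →+* ℂ} (V : HermSpace3 L ι₁) (c : SeesawCtx L),
    (cmSplittingDatum (L : Type) finProdFinEquiv (frameD V) (frameD_real V) (frameD_ne V) (dW c.D) (dW_real c.D)
      (dW_ne c.D)).CompatibleSplitting)
  (hGR₀ : ∀ {L : CMField} {ι₁ : L →+* ℂ} (V : HermSpace3 L ι₁) (c : SeesawCtx L),
    (cmSplittingDatum (L : Type) (ArchSideTerm.e₁) (frameD V) (frameD_real V) (frameD_ne V) (lineVec (L : Type) (dW c.D 0))
      (fun _ => dW_real c.D 0) (fun _ => dW_ne c.D 0)).CompatibleSplitting)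
  (hGR₁ : ∀ {L : CMField} {ι₁ : L →+* ℂ} (V : HermSpace3 L ι₁) (c : SeesawCtx L),
    (cmSplittingDatum (L : Type) (ArchSideTerm.e₁) (frameD V) (frameD_real V) (frameD_ne V) (lineVec (L : Type) (dW c.D 1))
      (fun _ => dW_real c.D 1) (fun _ => dW_ne c.D 1)).CompatibleSplitting)
  (hGR₂ : ∀ {L : CMField} {ι₁ : L →+* ℂ} (V : HermSpace3 L ι₁) (c : SeesawCtx L),
    (cmSplittingDatum (L : Type) (ArchSideTerm.e₁) (frameD V) (frameD_real V) (frameD_ne V) (lineVec (L : Type) (dW' c.D 0))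
      (fun _ => dW'_real c.D 0) (fun _ => dW'_ne c.D 0)).CompatibleSplitting)
  (hGR₃ : ∀ {L : CMField} {ι₁ : L →+* ℂ} (V : HermSpace3 L ι₁) (c : SeesawCtx L),
    (cmSplittingDatum (L : Type) (ArchSideTerm.e₁) (frameD V) (frameD_real V) (frameD_ne V) (lineVec (L : Type) (dW' c.D 1))
      (fun _ => dW'_real c.D 1) (fun _ => dW'_ne c.D 1)).CompatibleSplitting)
  (χW : ∀ {L : CMField} {ι₁ : L →+* ℂ} (_V : HermSpace3 L ι₁) (_c : SeesawCtx L),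
    ContinuousMonoidHom (Literature.NumberTheory.Automorphic.relNormOneIdeles (↥(NumberField.maximalRealSubfield (L : Type))) (L : Type) ⧸
      Literature.NumberTheory.Automorphic.relNormOneRat (↥(NumberField.maximalRealSubfield (L : Type))) (L : Type)) Circle)

variable {L : CMField} {ι₁ : L →+* ℂ} (V : HermSpace3 L ι₁) (c : SeesawCtx L) (hG : GOG V c)
  (η₀ η₁ : CMAdelic (L : Type) (frameD V) × CMAdelicOne (L : Type) →* ℂˣ)
  (hmaj : ∀ k : Fin 4, HasThetaMajorants fun (p : ↥(regimeSubgroup L V.Hm) × ↥(NumberField.relNormOneIdeles (↥(maximalRealSubfield L)) L))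
      (φ : piSchwartzBruhat (↥(maximalRealSubfield L)) (Fin 3)) =>
      lineRepOf V c.D (hGR V c) (hGR₀ V c) (hGR₁ V c) (hGR₂ V c) (hGR₃ V c) η₀ η₁
        (etaT₂ V c.D (EtaChi.η (@χVR @hGR @hGR₀ @hGR₁) @χW V c) (@ν'R @hGR₃ _ _ V c))
        (etaT₃ V c.D (EtaChi.η (@χVR @hGR @hGR₀ @hGR₁) @χW V c) (@ν'R @hGR₃ _ _ V c)) k p φ)
  (hrat : ∀ k : Fin 4, ∀ γ ∈ (V.latticeModel printFact_unitaryCompact_holds).Γ,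
      ∀ t ∈ NumberField.relNormOneRat (↥(maximalRealSubfield L)) L,
        lineRepOf V c.D (hGR V c) (hGR₀ V c) (hGR₁ V c) (hGR₂ V c) (hGR₃ V c) η₀ η₁
          (etaT₂ V c.D (EtaChi.η (@χVR @hGR @hGR₀ @hGR₁) @χW V c) (@ν'R @hGR₃ _ _ V c))
          (etaT₃ V c.D (EtaChi.η (@χVR @hGR @hGR₀ @hGR₁) @χW V c) (@ν'R @hGR₃ _ _ V c)) k (γ, t) ∈
          thetaStabilizerEnd (↥(maximalRealSubfield L)) (Fin 3))
  (A : ∀ k : Fin 4, ArchLineInput V (lineRepOf V c.D (hGR V c) (hGR₀ V c) (hGR₁ V c) (hGR₂ V c) (hGR₃ V c) η₀ η₁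
        (etaT₂ V c.D (EtaChi.η (@χVR @hGR @hGR₀ @hGR₁) @χW V c) (@ν'R @hGR₃ _ _ V c))
        (etaT₃ V c.D (EtaChi.η (@χVR @hGR @hGR₀ @hGR₁) @χW V c) (@ν'R @hGR₃ _ _ V c)) k))
  (hV : IsAnisotropic L V.Hm)

include hG in
/-- **(W-0-SUPPLY) FOR LINES 2, 3 AT PIN R2, HYPOTHESIS-FREE UNDER THE OG GUARD**: binder-1's `hsupply` text at the four-character side whose
conjugated lines carry `etaT₂ ∕ etaT₃ … (EtaChi.η χVR χW V c) (ν'R V c)` (lines 0, 1 and the side's Weil data arbitrary). -/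
theorem hsupply_two_three_R2_of_GOG :
    ∀ (x₂ x₃ : Fin 3 → FiniteAdeleRing (𝓞 ↥(maximalRealSubfield L)) ↥(maximalRealSubfield L)) (𝔫₂ 𝔫₃ : Ideal (𝓞 ↥(maximalRealSubfield L))),
      ∃ (B₂ : ArchKTypeDataAt (thetaSpaceInputIn hHD hI h₁ h₃
            (archSideOfChar V c (hGR V c) (hGR₀ V c) (hGR₁ V c) (hGR₂ V c) (hGR₃ V c) η₀ η₁
              (etaT₂ V c.D (EtaChi.η (@χVR @hGR @hGR₀ @hGR₁) @χW V c) (@ν'R @hGR₃ _ _ V c))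
              (etaT₃ V c.D (EtaChi.η (@χVR @hGR @hGR₀ @hGR₁) @χW V c) (@ν'R @hGR₃ _ _ V c)) hmaj hrat A) hV) 2 x₂ 𝔫₂)
        (B₃ : ArchKTypeDataAt (thetaSpaceInputIn hHD hI h₁ h₃
            (archSideOfChar V c (hGR V c) (hGR₀ V c) (hGR₁ V c) (hGR₂ V c) (hGR₃ V c) η₀ η₁
              (etaT₂ V c.D (EtaChi.η (@χVR @hGR @hGR₀ @hGR₁) @χW V c) (@ν'R @hGR₃ _ _ V c))
              (etaT₃ V c.D (EtaChi.η (@χVR @hGR @hGR₀ @hGR₁) @χW V c) (@ν'R @hGR₃ _ _ V c)) hmaj hrat A) hV) 3 x₃ 𝔫₃),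
        B₃.Γ₀ = B₂.Γ₀ ∧
          B₂.Φarch = blockFamilyOfAt (L : Type) e₁ (frameD V) (frameD_real V) (frameD_ne V) (lineVec (L : Type) (dW' c.D 0)) (fun _ => dW'_real c.D 0)
            (fun _ => dW'_ne c.D 0) ι₁ (blockPosEquiv V) (blockNegEquiv V) (posIdxEquivUnit (hpos_GOG V c hG).2.2.1)
            (negIdxEquivEmpty (hpos_GOG V c hG).2.2.1) (degOnePDual Empty) (binvPi 1) ∧
          B₃.Φarch = blockFamilyOfAt (L : Type) e₁ (frameD V) (frameD_real V) (frameD_ne V) (lineVec (L : Type) (dW' c.D 1)) (fun _ => dW'_real c.D 1)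
            (fun _ => dW'_ne c.D 1) ι₁ (blockPosEquiv V) (blockNegEquiv V) (posIdxEquivUnit (hpos_GOG V c hG).2.2.2)
            (negIdxEquivEmpty (hpos_GOG V c hG).2.2.2) (degOnePDual Empty) (binvPi 1) ∧
          B₂.IsWeaklyPDiff BallForms.expP ∧
          (∀ p : Fin 2, B₂.IsPMinusKilledAlong BallForms.expP (-Complex.I • (Pi.single p 1 : Fin 2 → ℂ))) ∧
          B₃.IsWeaklyPDiff BallForms.expP ∧
          (∀ p : Fin 2, B₃.IsPMinusKilledAlong BallForms.expP (-Complex.I • (Pi.single p 1 : Fin 2 → ℂ))) :=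
  hsupply_two_three_charG hHD hI h₁ h₃ V c (hGR V c) (hGR₀ V c) (hGR₁ V c) (hGR₂ V c) (hGR₃ V c) η₀ η₁ _ _ hmaj hrat (hG_GOG V c hG) A hV hG.1
    (hpos_GOG V c hG).2.2.1 (hpos_GOG V c hG).2.2.2
    (continuous_etaT₂ V c.D _ _ (EtaChi.hηc (@χVR @hGR @hGR₀ @hGR₁) @χW V c) (hν'cR @hGR₃ V c))
    (continuous_etaT₃ V c.D _ _ (EtaChi.hηc (@χVR @hGR @hGR₀ @hGR₁) @χW V c) (hν'cR @hGR₃ V c))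
    (hdef_two_R2_of_GOG @hGR @hGR₀ @hGR₁ @hGR₂ @hGR₃ @χW V c hG) (hdef_three_R2_of_GOG @hGR @hGR₀ @hGR₁ @hGR₂ @hGR₃ @χW V c hG)
    (hχ_two_R2_of_GOG @hGR @hGR₀ @hGR₁ @hGR₂ @hGR₃ @χW V c hG) (hχ_three_R2_of_GOG @hGR @hGR₀ @hGR₁ @hGR₂ @hGR₃ @χW V c hG)

/-! ## § 3 The same at period-1's packaged R2 term `archSideOfT'` -/

variable (ν : CMAdelic (L : Type) (frameD V) →* ℂˣ) (hν : ∀ γU ∈ CMRat (L : Type) (frameD V), ν γU = 1)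
  (hνc : Continuous fun v => ((ν v : ℂˣ) : ℂ))
  (A' : ∀ k : Fin 4, ArchLineInput V (lineRepT' V c.D (hGR V c) (hGR₀ V c) (hGR₁ V c) (hGR₂ V c) (hGR₃ V c)
      (EtaChi.η (@χVR @hGR @hGR₀ @hGR₁) @χW V c) ν (@ν'R @hGR₃ _ _ V c) k))

/-- period-1's doubly twisted term IS the four-character side at `(etaT₀ η ν, etaT₁ η ν, etaT₂ η ν′, etaT₃ η ν′)` with its two Weil hypotheses
PROVED (#P50b `hasThetaMajorants_lineRepT'`, `lineRepT'_mem_thetaStabilizerEnd`) — definitionally (`lineRepT'` is a reducible wrapper). -/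
theorem archSideOfT'_R2_eq_archSideOfChar :
    archSideOfT' V c (hGR V c) (hGR₀ V c) (hGR₁ V c) (hGR₂ V c) (hGR₃ V c)
        (EtaChi.η (@χVR @hGR @hGR₀ @hGR₁) @χW V c) (EtaChi.hη (@χVR @hGR @hGR₀ @hGR₁) @χW V c) (EtaChi.hηc (@χVR @hGR @hGR₀ @hGR₁) @χW V c)
        ν hν hνc (@ν'R @hGR₃ _ _ V c) (hν'R @hGR₃ V c) (hν'cR @hGR₃ V c) (hG_GOG V c hG) A' =
      archSideOfChar V c (hGR V c) (hGR₀ V c) (hGR₁ V c) (hGR₂ V c) (hGR₃ V c)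
        (etaT₀ V c.D (EtaChi.η (@χVR @hGR @hGR₀ @hGR₁) @χW V c) ν) (etaT₁ V c.D (EtaChi.η (@χVR @hGR @hGR₀ @hGR₁) @χW V c) ν)
        (etaT₂ V c.D (EtaChi.η (@χVR @hGR @hGR₀ @hGR₁) @χW V c) (@ν'R @hGR₃ _ _ V c))
        (etaT₃ V c.D (EtaChi.η (@χVR @hGR @hGR₀ @hGR₁) @χW V c) (@ν'R @hGR₃ _ _ V c))
        (hasThetaMajorants_lineRepT' V c.D (hGR V c) (hGR₀ V c) (hGR₁ V c) (hGR₂ V c) (hGR₃ V c) _ ν _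
          (EtaChi.hηc (@χVR @hGR @hGR₀ @hGR₁) @χW V c) hνc (hν'cR @hGR₃ V c) (hG_GOG V c hG))
        (lineRepT'_mem_thetaStabilizerEnd V c.D (hGR V c) (hGR₀ V c) (hGR₁ V c) (hGR₂ V c) (hGR₃ V c) _ ν _
          (EtaChi.hη (@χVR @hGR @hGR₀ @hGR₁) @χW V c) hν (hν'R @hGR₃ V c)) A' :=
  rfl

include hG in
/-- **(W-0-SUPPLY) FOR LINES 2, 3 AT period-1's R2 TERM `archSideOfT' … (EtaChi.η χVR χW) … ν … (ν'R V c) …`, HYPOTHESIS-FREE UNDER THE GUARD**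
(any first twist `ν` with its two slots, any archimedean test data `A'`). -/
theorem hsupply_two_three_archSideOfT'_of_GOG :
    ∀ (x₂ x₃ : Fin 3 → FiniteAdeleRing (𝓞 ↥(maximalRealSubfield L)) ↥(maximalRealSubfield L)) (𝔫₂ 𝔫₃ : Ideal (𝓞 ↥(maximalRealSubfield L))),
      ∃ (B₂ : ArchKTypeDataAt (thetaSpaceInputIn hHD hI h₁ h₃
            (archSideOfT' V c (hGR V c) (hGR₀ V c) (hGR₁ V c) (hGR₂ V c) (hGR₃ V c)
              (EtaChi.η (@χVR @hGR @hGR₀ @hGR₁) @χW V c) (EtaChi.hη (@χVR @hGR @hGR₀ @hGR₁) @χW V c)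
              (EtaChi.hηc (@χVR @hGR @hGR₀ @hGR₁) @χW V c) ν hν hνc (@ν'R @hGR₃ _ _ V c) (hν'R @hGR₃ V c) (hν'cR @hGR₃ V c)
              (hG_GOG V c hG) A') hV) 2 x₂ 𝔫₂)
        (B₃ : ArchKTypeDataAt (thetaSpaceInputIn hHD hI h₁ h₃
            (archSideOfT' V c (hGR V c) (hGR₀ V c) (hGR₁ V c) (hGR₂ V c) (hGR₃ V c)
              (EtaChi.η (@χVR @hGR @hGR₀ @hGR₁) @χW V c) (EtaChi.hη (@χVR @hGR @hGR₀ @hGR₁) @χW V c)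
              (EtaChi.hηc (@χVR @hGR @hGR₀ @hGR₁) @χW V c) ν hν hνc (@ν'R @hGR₃ _ _ V c) (hν'R @hGR₃ V c) (hν'cR @hGR₃ V c)
              (hG_GOG V c hG) A') hV) 3 x₃ 𝔫₃),
        B₃.Γ₀ = B₂.Γ₀ ∧
          B₂.Φarch = blockFamilyOfAt (L : Type) e₁ (frameD V) (frameD_real V) (frameD_ne V) (lineVec (L : Type) (dW' c.D 0)) (fun _ => dW'_real c.D 0)
            (fun _ => dW'_ne c.D 0) ι₁ (blockPosEquiv V) (blockNegEquiv V) (posIdxEquivUnit (hpos_GOG V c hG).2.2.1)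
            (negIdxEquivEmpty (hpos_GOG V c hG).2.2.1) (degOnePDual Empty) (binvPi 1) ∧
          B₃.Φarch = blockFamilyOfAt (L : Type) e₁ (frameD V) (frameD_real V) (frameD_ne V) (lineVec (L : Type) (dW' c.D 1)) (fun _ => dW'_real c.D 1)
            (fun _ => dW'_ne c.D 1) ι₁ (blockPosEquiv V) (blockNegEquiv V) (posIdxEquivUnit (hpos_GOG V c hG).2.2.2)
            (negIdxEquivEmpty (hpos_GOG V c hG).2.2.2) (degOnePDual Empty) (binvPi 1) ∧
          B₂.IsWeaklyPDiff BallForms.expP ∧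
          (∀ p : Fin 2, B₂.IsPMinusKilledAlong BallForms.expP (-Complex.I • (Pi.single p 1 : Fin 2 → ℂ))) ∧
          B₃.IsWeaklyPDiff BallForms.expP ∧
          (∀ p : Fin 2, B₃.IsPMinusKilledAlong BallForms.expP (-Complex.I • (Pi.single p 1 : Fin 2 → ℂ))) :=
  hsupply_two_three_R2_of_GOG hHD hI h₁ h₃ @hGR @hGR₀ @hGR₁ @hGR₂ @hGR₃ @χW V c hG _ _ _ _ A' hV

end SInstance

end HodgeCM.Model

end
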